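import Summits.Ventures.PercRepro.C025ProfilePLDColPlaneTwelveA
import Summits.Ventures.PercRepro.C025ProfilePLDColPlaneTwelveB
import Summits.Ventures.PercRepro.C025ProfilePLDColPlaneTwelveC
import Summits.Ventures.PercRepro.C025ProfilePLDColPlaneTwelveD
import Summits.Ventures.PercRepro.C025ProfilePLDColPlaneTwelveE
import Summits.Ventures.PercRepro.C025ProfilePLDColPlaneTwelveF
import Summits.Ventures.PercRepro.C025ProfilePLDColPlaneTwelveG
import Summits.Ventures.PercRepro.C025ProfilePLDColPlaneTwelveH
import Summits.Ventures.PercRepro.C025ProfilePLDColPlaneTwelveI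
import Summits.Ventures.PercRepro.C025ProfilePLDColPlaneTwelveJ
import Summits.Ventures.PercRepro.C025ProfilePLDColPlaneTwelveK
import Summits.Ventures.PercRepro.C025ProfilePLDColPlaneTwelveL
import Summits.Ventures.PercRepro.C025ProfilePLDColPlaneTwelveM
import Summits.Ventures.PercRepro.C025ProfilePLDColPlaneTwelveN
import Summits.Ventures.PercRepro.C025ProfilePLDColPlaneTwelveO
import Summits.Ventures.PercRepro.C025ProfilePLDColPlaneTwelveP
import Summits.Ventures.PercRepro.C025ProfilePLDColPlaneTwelveQ
import Summits.Ventures.PercRepro.C025ProfilePLDTwoFlat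

/-!
# THE COLOOP TRICK: PER-LAYER DOMINANCE FOR «M ⊕ U_{3,5} ⊕ coloop» FOR EVERY (PLD)-MATROID `M` OF RANK ≤ 12 (night-3 g36)

`proofs/NIGHT3-G36-CEILING.md` §2 (d).  `pld_disjointSum_uniform_3_5_coloop_of_eRank_le_12`: (PLD)(M) ∧ rank M ≤ 12 ⟹ (PLD)(M ⊕ (U_{3,5} ⊕ U_{1,1})) — the summand is the
uniform matroid `truncate (freeOn F) 3` (`|F| = 5`) plus one coloop `truncate (freeOn F') 1` (`|F'| = 1`).  Every (PLD) instance of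
`N ⊕ coloop` is the sum of three (PLD) instances of `N` (g27), so the conclusion is WEAKER than (PLD)(M ⊕ U_{3,5}) — and that is the
point: the bare instances of `M ⊕ U_{3,5}` stop being certifiable from the (PLD) instances of `M` at the base map's rank R₁
(`U_{2,3}`: rank 7, `C025ProfilePLDLineFarkasSeven`), while their coloop-sums are certifiable far beyond (`U_{2,3} ⊕ coloop`: every
rank ≤ 18, kit j336842).  With the bridge `PLDBridge.rls_disjointSum_freeOn_of_pld`, C-025 holds at every `(p, q)` on every truncation of
«M ⊕ U_{3,5} ⊕ a coloop ⊕ free points» — i.e. of `M ⊕ U_{3,5} ⊕ free points` with at least one free point.  The table: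
`col_uniform_3_5_table_12_part*` (17 parts, `decide`), through the certificate lemma `PLDCert.sum_le_of_cert`.
No `def`, no `instance`, no notation.  Axioms: standard.
-/

open scoped Matroid

namespace PercRepro

open Finset ThmH

namespace PLDColoop

variable {α : Type} [DecidableEq α]

set_option maxRecDepth 16384 in
/-- THE COLOOP TRICK: (PLD) FOR «M ⊕ (U_{3,5} ⊕ coloop)» FOR EVERY (PLD)-MATROID `M` OF RANK ≤ 12. -/
theorem pld_disjointSum_uniform_3_5_coloop_of_eRank_le_12 (M : Matroid α) [M.Finite] (hr : M.eRank ≤ 12)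
    (hPLD : ∀ lo hi δ Θ : ℕ, Θ ≤ lo + hi + δ → (lo = 0 ∨ lo + hi + δ ≤ Θ) →
      (∑ I ∈ (gr M).powerset, (if lo ≤ (M.eRk (I : Set α)).toNat ∧ (M.eRk (I : Set α)).toNat ≤ hi ∧
          Θ ≤ (M.eRk ((gr M \ I : Finset α) : Set α)).toNat + (M.eRk (I : Set α)).toNat then
          ((M.eRk ((gr M \ I : Finset α) : Set α)).toNat).choose δ else 0)) ≤
        ∑ I ∈ (gr M).powerset, (if lo + δ ≤ (M.eRk ((gr M \ I : Finset α) : Set α)).toNat ∧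
          (M.eRk ((gr M \ I : Finset α) : Set α)).toNat ≤ hi + δ then
          ((M.eRk ((gr M \ I : Finset α) : Set α)).toNat).choose δ else 0))
    (F F' : Finset α) (hF : F.card = 5) (hF' : F'.card = 1)
    (h' : Disjoint (@Matroid.truncate α (Matroid.freeOn (F : Set α)) (PLDTruncate.freeOn_finite' F) 3).E
      (@Matroid.truncate α (Matroid.freeOn (F' : Set α)) (PLDTruncate.freeOn_finite' F') 1).E)
    (h : Disjoint M.E ((@Matroid.truncate α (Matroid.freeOn (F : Set α)) (PLDTruncate.freeOn_finite' F) 3).disjointSum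
      (@Matroid.truncate α (Matroid.freeOn (F' : Set α)) (PLDTruncate.freeOn_finite' F') 1) h').E) :
    haveI := PLDTruncate.freeOn_finite' F
    haveI := PLDTruncate.freeOn_finite' F'
    haveI := PLDClosure.disjointSum_finite' _ _ h'
    haveI := PLDClosure.disjointSum_finite' _ _ h
    ∀ lo hi δ Θ : ℕ, Θ ≤ lo + hi + δ → (lo = 0 ∨ lo + hi + δ ≤ Θ) →
      (∑ I ∈ (gr (M.disjointSum ((Matroid.truncate (Matroid.freeOn (F : Set α)) 3).disjointSum (Matroid.truncate (Matroid.freeOn (F' : Set α)) 1) h') h)).powerset, (if lo ≤ ((M.disjointSum ((Matroid.truncate (Matroid.freeOn (F : Set α)) 3).disjointSum (Matroid.truncate (Matroid.freeOn (F' : Set α)) 1) h') h).eRk (I : Set α)).toNat ∧ ((M.disjointSum ((Matroid.truncate (Matroid.freeOn (F : Set α)) 3).disjointSum (Matroid.truncate (Matroid.freeOn (F' : Set α)) 1) h') h).eRk (I : Set α)).toNat ≤ hi ∧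
          Θ ≤ ((M.disjointSum ((Matroid.truncate (Matroid.freeOn (F : Set α)) 3).disjointSum (Matroid.truncate (Matroid.freeOn (F' : Set α)) 1) h') h).eRk ((gr (M.disjointSum ((Matroid.truncate (Matroid.freeOn (F : Set α)) 3).disjointSum (Matroid.truncate (Matroid.freeOn (F' : Set α)) 1) h') h) \ I : Finset α) : Set α)).toNat + ((M.disjointSum ((Matroid.truncate (Matroid.freeOn (F : Set α)) 3).disjointSum (Matroid.truncate (Matroid.freeOn (F' : Set α)) 1) h') h).eRk (I : Set α)).toNat then
          (((M.disjointSum ((Matroid.truncate (Matroid.freeOn (F : Set α)) 3).disjointSum (Matroid.truncate (Matroid.freeOn (F' : Set α)) 1) h') h).eRk ((gr (M.disjointSum ((Matroid.truncate (Matroid.freeOn (F : Set α)) 3).disjointSum (Matroid.truncate (Matroid.freeOn (F' : Set α)) 1) h') h) \ I : Finset α) : Set α)).toNat).choose δ else 0)) ≤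
        ∑ I ∈ (gr (M.disjointSum ((Matroid.truncate (Matroid.freeOn (F : Set α)) 3).disjointSum (Matroid.truncate (Matroid.freeOn (F' : Set α)) 1) h') h)).powerset, (if lo + δ ≤ ((M.disjointSum ((Matroid.truncate (Matroid.freeOn (F : Set α)) 3).disjointSum (Matroid.truncate (Matroid.freeOn (F' : Set α)) 1) h') h).eRk ((gr (M.disjointSum ((Matroid.truncate (Matroid.freeOn (F : Set α)) 3).disjointSum (Matroid.truncate (Matroid.freeOn (F' : Set α)) 1) h') h) \ I : Finset α) : Set α)).toNat ∧
          ((M.disjointSum ((Matroid.truncate (Matroid.freeOn (F : Set α)) 3).disjointSum (Matroid.truncate (Matroid.freeOn (F' : Set α)) 1) h') h).eRk ((gr (M.disjointSum ((Matroid.truncate (Matroid.freeOn (F : Set α)) 3).disjointSum (Matroid.truncate (Matroid.freeOn (F' : Set α)) 1) h') h) \ I : Finset α) : Set α)).toNat ≤ hi + δ then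
          (((M.disjointSum ((Matroid.truncate (Matroid.freeOn (F : Set α)) 3).disjointSum (Matroid.truncate (Matroid.freeOn (F' : Set α)) 1) h') h).eRk ((gr (M.disjointSum ((Matroid.truncate (Matroid.freeOn (F : Set α)) 3).disjointSum (Matroid.truncate (Matroid.freeOn (F' : Set α)) 1) h') h) \ I : Finset α) : Set α)).toNat).choose δ else 0) := by
  haveI := PLDTruncate.freeOn_finite' F
  haveI := PLDTruncate.freeOn_finite' F'
  haveI := PLDClosure.disjointSum_finite' _ _ h'
  haveI := PLDClosure.disjointSum_finite' _ _ h
  have hU : (Matroid.truncate (Matroid.freeOn (F : Set α)) 3).eRank ≤ ((3 : ℕ) : ℕ∞) := by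
    rw [Matroid.truncate_eRank]; exact min_le_right _ _
  have hC : (Matroid.truncate (Matroid.freeOn (F' : Set α)) 1).eRank ≤ ((1 : ℕ) : ℕ∞) := by
    rw [Matroid.truncate_eRank]; exact min_le_right _ _
  have hr' : M.eRank ≤ ((12 : ℕ) : ℕ∞) := by exact_mod_cast hr
  have hb : ∀ I ∈ (gr (M.disjointSum ((Matroid.truncate (Matroid.freeOn (F : Set α)) 3).disjointSum (Matroid.truncate (Matroid.freeOn (F' : Set α)) 1) h') h)).powerset,
      ((M.disjointSum ((Matroid.truncate (Matroid.freeOn (F : Set α)) 3).disjointSum (Matroid.truncate (Matroid.freeOn (F' : Set α)) 1) h') h).eRk (I : Set α)).toNat ≤ 16 ∧ ((M.disjointSum ((Matroid.truncate (Matroid.freeOn (F : Set α)) 3).disjointSum (Matroid.truncate (Matroid.freeOn (F' : Set α)) 1) h') h).eRk ((gr (M.disjointSum ((Matroid.truncate (Matroid.freeOn (F : Set α)) 3).disjointSum (Matroid.truncate (Matroid.freeOn (F' : Set α)) 1) h') h) \ I : Finset α) : Set α)).toNat ≤ 16 := by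
    intro I _
    constructor
    · rw [PLDClosure.toNat_eRk_disjointSum, PLDClosure.toNat_eRk_disjointSum]
      have h1 := PLDCert.toNat_eRk_le_of_eRank_le M hr' ((I ∩ gr M : Finset α) : Set α)
      have h2 := PLDCert.toNat_eRk_le_of_eRank_le _ hU (((I ∩ gr ((Matroid.truncate (Matroid.freeOn (F : Set α)) 3).disjointSum (Matroid.truncate (Matroid.freeOn (F' : Set α)) 1) h')) ∩ gr (Matroid.truncate (Matroid.freeOn (F : Set α)) 3) : Finset α) : Set α)
      have h3 := PLDCert.toNat_eRk_le_of_eRank_le _ hC (((I ∩ gr ((Matroid.truncate (Matroid.freeOn (F : Set α)) 3).disjointSum (Matroid.truncate (Matroid.freeOn (F' : Set α)) 1) h')) ∩ gr (Matroid.truncate (Matroid.freeOn (F' : Set α)) 1) : Finset α) : Set α)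
      omega
    · rw [PLDClosure.toNat_eRk_disjointSum, PLDClosure.toNat_eRk_disjointSum]
      have h1 := PLDCert.toNat_eRk_le_of_eRank_le M hr' (((gr (M.disjointSum ((Matroid.truncate (Matroid.freeOn (F : Set α)) 3).disjointSum (Matroid.truncate (Matroid.freeOn (F' : Set α)) 1) h') h) \ I) ∩ gr M : Finset α) : Set α)
      have h2 := PLDCert.toNat_eRk_le_of_eRank_le _ hU ((((gr (M.disjointSum ((Matroid.truncate (Matroid.freeOn (F : Set α)) 3).disjointSum (Matroid.truncate (Matroid.freeOn (F' : Set α)) 1) h') h) \ I) ∩ gr ((Matroid.truncate (Matroid.freeOn (F : Set α)) 3).disjointSum (Matroid.truncate (Matroid.freeOn (F' : Set α)) 1) h')) ∩ gr (Matroid.truncate (Matroid.freeOn (F : Set α)) 3) : Finset α) : Set α)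
      have h3 := PLDCert.toNat_eRk_le_of_eRank_le _ hC ((((gr (M.disjointSum ((Matroid.truncate (Matroid.freeOn (F : Set α)) 3).disjointSum (Matroid.truncate (Matroid.freeOn (F' : Set α)) 1) h') h) \ I) ∩ gr ((Matroid.truncate (Matroid.freeOn (F : Set α)) 3).disjointSum (Matroid.truncate (Matroid.freeOn (F' : Set α)) 1) h')) ∩ gr (Matroid.truncate (Matroid.freeOn (F' : Set α)) 1) : Finset α) : Set α)
      omega
  refine PLDSymCex.pld_of_bounded (gr (M.disjointSum ((Matroid.truncate (Matroid.freeOn (F : Set α)) 3).disjointSum (Matroid.truncate (Matroid.freeOn (F' : Set α)) 1) h') h)).powerset (fun I : Finset α => ((M.disjointSum ((Matroid.truncate (Matroid.freeOn (F : Set α)) 3).disjointSum (Matroid.truncate (Matroid.freeOn (F' : Set α)) 1) h') h).eRk (I : Set α)).toNat)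
    (fun I : Finset α => ((M.disjointSum ((Matroid.truncate (Matroid.freeOn (F : Set α)) 3).disjointSum (Matroid.truncate (Matroid.freeOn (F' : Set α)) 1) h') h).eRk ((gr (M.disjointSum ((Matroid.truncate (Matroid.freeOn (F : Set α)) 3).disjointSum (Matroid.truncate (Matroid.freeOn (F' : Set α)) 1) h') h) \ I : Finset α) : Set α)).toNat) 16 hb ?_
  intro lo hi δ hlh hhR hδR
  have hL := PLDClosure.sum_powerset_disjointSum M _ h
    (fun x f => if lo ≤ x ∧ x ≤ hi ∧ (if lo = 0 then 0 else lo + hi + δ) ≤ f + x then f.choose δ else 0)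
  have hR := PLDClosure.sum_powerset_disjointSum M _ h
    (fun x f => if lo + δ ≤ f ∧ f ≤ hi + δ then f.choose δ else 0)
  beta_reduce at hL hR
  rw [hL, hR]
  -- the inner sum over the powerset of `U ⊕ coloop`: two decompositions
  have h2L : ∀ x₁ f₁ : ℕ,
      ∑ I₂ ∈ (gr ((Matroid.truncate (Matroid.freeOn (F : Set α)) 3).disjointSum (Matroid.truncate (Matroid.freeOn (F' : Set α)) 1) h')).powerset,
        (if lo ≤ x₁ + (((Matroid.truncate (Matroid.freeOn (F : Set α)) 3).disjointSum (Matroid.truncate (Matroid.freeOn (F' : Set α)) 1) h').eRk (I₂ : Set α)).toNat ∧ x₁ + (((Matroid.truncate (Matroid.freeOn (F : Set α)) 3).disjointSum (Matroid.truncate (Matroid.freeOn (F' : Set α)) 1) h').eRk (I₂ : Set α)).toNat ≤ hi ∧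
            (if lo = 0 then 0 else lo + hi + δ) ≤ f₁ + (((Matroid.truncate (Matroid.freeOn (F : Set α)) 3).disjointSum (Matroid.truncate (Matroid.freeOn (F' : Set α)) 1) h').eRk ((gr ((Matroid.truncate (Matroid.freeOn (F : Set α)) 3).disjointSum (Matroid.truncate (Matroid.freeOn (F' : Set α)) 1) h') \ I₂ : Finset α) : Set α)).toNat +
              (x₁ + (((Matroid.truncate (Matroid.freeOn (F : Set α)) 3).disjointSum (Matroid.truncate (Matroid.freeOn (F' : Set α)) 1) h').eRk (I₂ : Set α)).toNat) then
          (f₁ + (((Matroid.truncate (Matroid.freeOn (F : Set α)) 3).disjointSum (Matroid.truncate (Matroid.freeOn (F' : Set α)) 1) h').eRk ((gr ((Matroid.truncate (Matroid.freeOn (F : Set α)) 3).disjointSum (Matroid.truncate (Matroid.freeOn (F' : Set α)) 1) h') \ I₂ : Finset α) : Set α)).toNat).choose δ else 0) =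
      (∑ i ∈ range 6, Nat.choose 5 i * ((if lo ≤ x₁ + min i 3 ∧ x₁ + min i 3 ≤ hi ∧ (if lo = 0 then 0 else lo + hi + δ) ≤ f₁ + (min (5 - i) 3 + 1) + (x₁ + min i 3) then (f₁ + (min (5 - i) 3 + 1)).choose δ else 0) + (if lo ≤ x₁ + (min i 3 + 1) ∧ x₁ + (min i 3 + 1) ≤ hi ∧ (if lo = 0 then 0 else lo + hi + δ) ≤ f₁ + min (5 - i) 3 + (x₁ + (min i 3 + 1)) then (f₁ + min (5 - i) 3).choose δ else 0))) := by
    intro x₁ f₁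
    have h1 := PLDClosure.sum_powerset_disjointSum (Matroid.truncate (Matroid.freeOn (F : Set α)) 3) (Matroid.truncate (Matroid.freeOn (F' : Set α)) 1) h' (fun x₂ f₂ => if lo ≤ x₁ + x₂ ∧ x₁ + x₂ ≤ hi ∧ (if lo = 0 then 0 else lo + hi + δ) ≤ f₁ + f₂ + (x₁ + x₂) then (f₁ + f₂).choose δ else 0)
    beta_reduce at h1
    have h2 : ∀ J : Finset α,
        ∑ K ∈ (gr (Matroid.truncate (Matroid.freeOn (F' : Set α)) 1)).powerset,
          (if lo ≤ x₁ + (((Matroid.truncate (Matroid.freeOn (F : Set α)) 3).eRk (J : Set α)).toNat + ((Matroid.truncate (Matroid.freeOn (F' : Set α)) 1).eRk (K : Set α)).toNat) ∧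
              x₁ + (((Matroid.truncate (Matroid.freeOn (F : Set α)) 3).eRk (J : Set α)).toNat + ((Matroid.truncate (Matroid.freeOn (F' : Set α)) 1).eRk (K : Set α)).toNat) ≤ hi ∧
              (if lo = 0 then 0 else lo + hi + δ) ≤ f₁ + (((Matroid.truncate (Matroid.freeOn (F : Set α)) 3).eRk ((gr (Matroid.truncate (Matroid.freeOn (F : Set α)) 3) \ J : Finset α) : Set α)).toNat +
                ((Matroid.truncate (Matroid.freeOn (F' : Set α)) 1).eRk ((gr (Matroid.truncate (Matroid.freeOn (F' : Set α)) 1) \ K : Finset α) : Set α)).toNat) +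
                (x₁ + (((Matroid.truncate (Matroid.freeOn (F : Set α)) 3).eRk (J : Set α)).toNat + ((Matroid.truncate (Matroid.freeOn (F' : Set α)) 1).eRk (K : Set α)).toNat)) then
            (f₁ + (((Matroid.truncate (Matroid.freeOn (F : Set α)) 3).eRk ((gr (Matroid.truncate (Matroid.freeOn (F : Set α)) 3) \ J : Finset α) : Set α)).toNat +
              ((Matroid.truncate (Matroid.freeOn (F' : Set α)) 1).eRk ((gr (Matroid.truncate (Matroid.freeOn (F' : Set α)) 1) \ K : Finset α) : Set α)).toNat)).choose δ else 0) =
        ∑ j ∈ range 2, Nat.choose 1 j *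
          (if lo ≤ x₁ + (((Matroid.truncate (Matroid.freeOn (F : Set α)) 3).eRk (J : Set α)).toNat + min j 1) ∧ x₁ + (((Matroid.truncate (Matroid.freeOn (F : Set α)) 3).eRk (J : Set α)).toNat + min j 1) ≤ hi ∧
              (if lo = 0 then 0 else lo + hi + δ) ≤ f₁ + (((Matroid.truncate (Matroid.freeOn (F : Set α)) 3).eRk ((gr (Matroid.truncate (Matroid.freeOn (F : Set α)) 3) \ J : Finset α) : Set α)).toNat + min (1 - j) 1) +
                (x₁ + (((Matroid.truncate (Matroid.freeOn (F : Set α)) 3).eRk (J : Set α)).toNat + min j 1)) then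
            (f₁ + (((Matroid.truncate (Matroid.freeOn (F : Set α)) 3).eRk ((gr (Matroid.truncate (Matroid.freeOn (F : Set α)) 3) \ J : Finset α) : Set α)).toNat + min (1 - j) 1)).choose δ else 0) := by
      intro J
      have := PLDTruncate.sum_powerset_truncate_freeOn F' 1
        (fun x₃ f₃ => if lo ≤ x₁ + (((Matroid.truncate (Matroid.freeOn (F : Set α)) 3).eRk (J : Set α)).toNat + x₃) ∧ x₁ + (((Matroid.truncate (Matroid.freeOn (F : Set α)) 3).eRk (J : Set α)).toNat + x₃) ≤ hi ∧
            (if lo = 0 then 0 else lo + hi + δ) ≤ f₁ + (((Matroid.truncate (Matroid.freeOn (F : Set α)) 3).eRk ((gr (Matroid.truncate (Matroid.freeOn (F : Set α)) 3) \ J : Finset α) : Set α)).toNat + f₃) +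
              (x₁ + (((Matroid.truncate (Matroid.freeOn (F : Set α)) 3).eRk (J : Set α)).toNat + x₃)) then
          (f₁ + (((Matroid.truncate (Matroid.freeOn (F : Set α)) 3).eRk ((gr (Matroid.truncate (Matroid.freeOn (F : Set α)) 3) \ J : Finset α) : Set α)).toNat + f₃)).choose δ else 0)
      beta_reduce at this
      rw [hF'] at this
      exact this
    simp only [h2] at h1
    have h3 := PLDTruncate.sum_powerset_truncate_freeOn F 3
      (fun x₂ f₂ => ∑ j ∈ range 2, Nat.choose 1 j *
        (if lo ≤ x₁ + (x₂ + min j 1) ∧ x₁ + (x₂ + min j 1) ≤ hi ∧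
            (if lo = 0 then 0 else lo + hi + δ) ≤ f₁ + (f₂ + min (1 - j) 1) + (x₁ + (x₂ + min j 1)) then
          (f₁ + (f₂ + min (1 - j) 1)).choose δ else 0))
    beta_reduce at h3
    rw [hF] at h3
    rw [h3] at h1
    have h4 : ∀ c : ℕ → ℕ, ∑ j ∈ range 2, Nat.choose 1 j * c j = c 0 + c 1 := by
      intro c; simp [Finset.sum_range_succ]
    simp only [h4, Nat.sub_zero, Nat.sub_self, Nat.zero_min, min_self, add_zero] at h1
    exact h1
  have h2R : ∀ f₁ : ℕ,
      ∑ I₂ ∈ (gr ((Matroid.truncate (Matroid.freeOn (F : Set α)) 3).disjointSum (Matroid.truncate (Matroid.freeOn (F' : Set α)) 1) h')).powerset,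
        (if lo + δ ≤ f₁ + (((Matroid.truncate (Matroid.freeOn (F : Set α)) 3).disjointSum (Matroid.truncate (Matroid.freeOn (F' : Set α)) 1) h').eRk ((gr ((Matroid.truncate (Matroid.freeOn (F : Set α)) 3).disjointSum (Matroid.truncate (Matroid.freeOn (F' : Set α)) 1) h') \ I₂ : Finset α) : Set α)).toNat ∧
            f₁ + (((Matroid.truncate (Matroid.freeOn (F : Set α)) 3).disjointSum (Matroid.truncate (Matroid.freeOn (F' : Set α)) 1) h').eRk ((gr ((Matroid.truncate (Matroid.freeOn (F : Set α)) 3).disjointSum (Matroid.truncate (Matroid.freeOn (F' : Set α)) 1) h') \ I₂ : Finset α) : Set α)).toNat ≤ hi + δ then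
          (f₁ + (((Matroid.truncate (Matroid.freeOn (F : Set α)) 3).disjointSum (Matroid.truncate (Matroid.freeOn (F' : Set α)) 1) h').eRk ((gr ((Matroid.truncate (Matroid.freeOn (F : Set α)) 3).disjointSum (Matroid.truncate (Matroid.freeOn (F' : Set α)) 1) h') \ I₂ : Finset α) : Set α)).toNat).choose δ else 0) =
      (∑ i ∈ range 6, Nat.choose 5 i * ((if lo + δ ≤ f₁ + (min (5 - i) 3 + 1) ∧ f₁ + (min (5 - i) 3 + 1) ≤ hi + δ then (f₁ + (min (5 - i) 3 + 1)).choose δ else 0) + (if lo + δ ≤ f₁ + min (5 - i) 3 ∧ f₁ + min (5 - i) 3 ≤ hi + δ then (f₁ + min (5 - i) 3).choose δ else 0))) := by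
    intro f₁
    have h1 := PLDClosure.sum_powerset_disjointSum (Matroid.truncate (Matroid.freeOn (F : Set α)) 3) (Matroid.truncate (Matroid.freeOn (F' : Set α)) 1) h' (fun x₂ f₂ => if lo + δ ≤ f₁ + f₂ ∧ f₁ + f₂ ≤ hi + δ then (f₁ + f₂).choose δ else 0)
    beta_reduce at h1
    have h2 : ∀ J : Finset α,
        ∑ K ∈ (gr (Matroid.truncate (Matroid.freeOn (F' : Set α)) 1)).powerset,
          (if lo + δ ≤ f₁ + (((Matroid.truncate (Matroid.freeOn (F : Set α)) 3).eRk ((gr (Matroid.truncate (Matroid.freeOn (F : Set α)) 3) \ J : Finset α) : Set α)).toNat + ((Matroid.truncate (Matroid.freeOn (F' : Set α)) 1).eRk ((gr (Matroid.truncate (Matroid.freeOn (F' : Set α)) 1) \ K : Finset α) : Set α)).toNat) ∧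
              f₁ + (((Matroid.truncate (Matroid.freeOn (F : Set α)) 3).eRk ((gr (Matroid.truncate (Matroid.freeOn (F : Set α)) 3) \ J : Finset α) : Set α)).toNat + ((Matroid.truncate (Matroid.freeOn (F' : Set α)) 1).eRk ((gr (Matroid.truncate (Matroid.freeOn (F' : Set α)) 1) \ K : Finset α) : Set α)).toNat) ≤ hi + δ then
            (f₁ + (((Matroid.truncate (Matroid.freeOn (F : Set α)) 3).eRk ((gr (Matroid.truncate (Matroid.freeOn (F : Set α)) 3) \ J : Finset α) : Set α)).toNat + ((Matroid.truncate (Matroid.freeOn (F' : Set α)) 1).eRk ((gr (Matroid.truncate (Matroid.freeOn (F' : Set α)) 1) \ K : Finset α) : Set α)).toNat)).choose δ else 0) =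
        ∑ j ∈ range 2, Nat.choose 1 j *
          (if lo + δ ≤ f₁ + (((Matroid.truncate (Matroid.freeOn (F : Set α)) 3).eRk ((gr (Matroid.truncate (Matroid.freeOn (F : Set α)) 3) \ J : Finset α) : Set α)).toNat + min (1 - j) 1) ∧
              f₁ + (((Matroid.truncate (Matroid.freeOn (F : Set α)) 3).eRk ((gr (Matroid.truncate (Matroid.freeOn (F : Set α)) 3) \ J : Finset α) : Set α)).toNat + min (1 - j) 1) ≤ hi + δ then
            (f₁ + (((Matroid.truncate (Matroid.freeOn (F : Set α)) 3).eRk ((gr (Matroid.truncate (Matroid.freeOn (F : Set α)) 3) \ J : Finset α) : Set α)).toNat + min (1 - j) 1)).choose δ else 0) := by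
      intro J
      have := PLDTruncate.sum_powerset_truncate_freeOn F' 1
        (fun x₃ f₃ => if lo + δ ≤ f₁ + (((Matroid.truncate (Matroid.freeOn (F : Set α)) 3).eRk ((gr (Matroid.truncate (Matroid.freeOn (F : Set α)) 3) \ J : Finset α) : Set α)).toNat + f₃) ∧
            f₁ + (((Matroid.truncate (Matroid.freeOn (F : Set α)) 3).eRk ((gr (Matroid.truncate (Matroid.freeOn (F : Set α)) 3) \ J : Finset α) : Set α)).toNat + f₃) ≤ hi + δ then
          (f₁ + (((Matroid.truncate (Matroid.freeOn (F : Set α)) 3).eRk ((gr (Matroid.truncate (Matroid.freeOn (F : Set α)) 3) \ J : Finset α) : Set α)).toNat + f₃)).choose δ else 0)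
      beta_reduce at this
      rw [hF'] at this
      exact this
    simp only [h2] at h1
    have h3 := PLDTruncate.sum_powerset_truncate_freeOn F 3
      (fun x₂ f₂ => ∑ j ∈ range 2, Nat.choose 1 j *
        (if lo + δ ≤ f₁ + (f₂ + min (1 - j) 1) ∧ f₁ + (f₂ + min (1 - j) 1) ≤ hi + δ then
          (f₁ + (f₂ + min (1 - j) 1)).choose δ else 0))
    beta_reduce at h3
    rw [hF] at h3
    rw [h3] at h1
    have h4 : ∀ c : ℕ → ℕ, ∑ j ∈ range 2, Nat.choose 1 j * c j = c 0 + c 1 := by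
      intro c; simp [Finset.sum_range_succ]
    simp only [h4, Nat.sub_zero, Nat.sub_self, Nat.zero_min, min_self, add_zero] at h1
    exact h1
  simp only [h2L, h2R]
  rcases Nat.lt_or_ge δ 1 with hδ0 | hδ0
  · obtain ⟨hDpos, hadm, hcert⟩ := col_uniform_3_5_table_12_part0 _ rfl lo (mem_range.2 (by omega)) hi (mem_range.2 (by omega))
      δ (mem_range.2 (by omega)) hlh
    have key := PLDCert.sum_le_of_cert M hPLD 12 hr' _ hadm _ _ hcert
    rw [← Finset.mul_sum, ← Finset.mul_sum] at key
    exact Nat.le_of_mul_le_mul_left key hDpos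
  rcases Nat.lt_or_ge δ 2 with hδ1 | hδ1
  · obtain ⟨hDpos, hadm, hcert⟩ := col_uniform_3_5_table_12_part1 _ rfl lo (mem_range.2 (by omega)) hi (mem_range.2 (by omega))
      δ (mem_Ico.2 ⟨by omega, by omega⟩) hlh
    have key := PLDCert.sum_le_of_cert M hPLD 12 hr' _ hadm _ _ hcert
    rw [← Finset.mul_sum, ← Finset.mul_sum] at key
    exact Nat.le_of_mul_le_mul_left key hDpos
  rcases Nat.lt_or_ge δ 3 with hδ2 | hδ2
  · obtain ⟨hDpos, hadm, hcert⟩ := col_uniform_3_5_table_12_part2 _ rfl lo (mem_range.2 (by omega)) hi (mem_range.2 (by omega))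
      δ (mem_Ico.2 ⟨by omega, by omega⟩) hlh
    have key := PLDCert.sum_le_of_cert M hPLD 12 hr' _ hadm _ _ hcert
    rw [← Finset.mul_sum, ← Finset.mul_sum] at key
    exact Nat.le_of_mul_le_mul_left key hDpos
  rcases Nat.lt_or_ge δ 4 with hδ3 | hδ3
  · obtain ⟨hDpos, hadm, hcert⟩ := col_uniform_3_5_table_12_part3 _ rfl lo (mem_range.2 (by omega)) hi (mem_range.2 (by omega))
      δ (mem_Ico.2 ⟨by omega, by omega⟩) hlh
    have key := PLDCert.sum_le_of_cert M hPLD 12 hr' _ hadm _ _ hcert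
    rw [← Finset.mul_sum, ← Finset.mul_sum] at key
    exact Nat.le_of_mul_le_mul_left key hDpos
  rcases Nat.lt_or_ge δ 5 with hδ4 | hδ4
  · obtain ⟨hDpos, hadm, hcert⟩ := col_uniform_3_5_table_12_part4 _ rfl lo (mem_range.2 (by omega)) hi (mem_range.2 (by omega))
      δ (mem_Ico.2 ⟨by omega, by omega⟩) hlh
    have key := PLDCert.sum_le_of_cert M hPLD 12 hr' _ hadm _ _ hcert
    rw [← Finset.mul_sum, ← Finset.mul_sum] at key
    exact Nat.le_of_mul_le_mul_left key hDpos
  rcases Nat.lt_or_ge δ 6 with hδ5 | hδ5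
  · obtain ⟨hDpos, hadm, hcert⟩ := col_uniform_3_5_table_12_part5 _ rfl lo (mem_range.2 (by omega)) hi (mem_range.2 (by omega))
      δ (mem_Ico.2 ⟨by omega, by omega⟩) hlh
    have key := PLDCert.sum_le_of_cert M hPLD 12 hr' _ hadm _ _ hcert
    rw [← Finset.mul_sum, ← Finset.mul_sum] at key
    exact Nat.le_of_mul_le_mul_left key hDpos
  rcases Nat.lt_or_ge δ 7 with hδ6 | hδ6
  · obtain ⟨hDpos, hadm, hcert⟩ := col_uniform_3_5_table_12_part6 _ rfl lo (mem_range.2 (by omega)) hi (mem_range.2 (by omega))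
      δ (mem_Ico.2 ⟨by omega, by omega⟩) hlh
    have key := PLDCert.sum_le_of_cert M hPLD 12 hr' _ hadm _ _ hcert
    rw [← Finset.mul_sum, ← Finset.mul_sum] at key
    exact Nat.le_of_mul_le_mul_left key hDpos
  rcases Nat.lt_or_ge δ 8 with hδ7 | hδ7
  · obtain ⟨hDpos, hadm, hcert⟩ := col_uniform_3_5_table_12_part7 _ rfl lo (mem_range.2 (by omega)) hi (mem_range.2 (by omega))
      δ (mem_Ico.2 ⟨by omega, by omega⟩) hlh
    have key := PLDCert.sum_le_of_cert M hPLD 12 hr' _ hadm _ _ hcert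
    rw [← Finset.mul_sum, ← Finset.mul_sum] at key
    exact Nat.le_of_mul_le_mul_left key hDpos
  rcases Nat.lt_or_ge δ 9 with hδ8 | hδ8
  · obtain ⟨hDpos, hadm, hcert⟩ := col_uniform_3_5_table_12_part8 _ rfl lo (mem_range.2 (by omega)) hi (mem_range.2 (by omega))
      δ (mem_Ico.2 ⟨by omega, by omega⟩) hlh
    have key := PLDCert.sum_le_of_cert M hPLD 12 hr' _ hadm _ _ hcert
    rw [← Finset.mul_sum, ← Finset.mul_sum] at key
    exact Nat.le_of_mul_le_mul_left key hDpos
  rcases Nat.lt_or_ge δ 10 with hδ9 | hδ9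
  · obtain ⟨hDpos, hadm, hcert⟩ := col_uniform_3_5_table_12_part9 _ rfl lo (mem_range.2 (by omega)) hi (mem_range.2 (by omega))
      δ (mem_Ico.2 ⟨by omega, by omega⟩) hlh
    have key := PLDCert.sum_le_of_cert M hPLD 12 hr' _ hadm _ _ hcert
    rw [← Finset.mul_sum, ← Finset.mul_sum] at key
    exact Nat.le_of_mul_le_mul_left key hDpos
  rcases Nat.lt_or_ge δ 11 with hδ10 | hδ10
  · obtain ⟨hDpos, hadm, hcert⟩ := col_uniform_3_5_table_12_part10 _ rfl lo (mem_range.2 (by omega)) hi (mem_range.2 (by omega))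
      δ (mem_Ico.2 ⟨by omega, by omega⟩) hlh
    have key := PLDCert.sum_le_of_cert M hPLD 12 hr' _ hadm _ _ hcert
    rw [← Finset.mul_sum, ← Finset.mul_sum] at key
    exact Nat.le_of_mul_le_mul_left key hDpos
  rcases Nat.lt_or_ge δ 12 with hδ11 | hδ11
  · obtain ⟨hDpos, hadm, hcert⟩ := col_uniform_3_5_table_12_part11 _ rfl lo (mem_range.2 (by omega)) hi (mem_range.2 (by omega))
      δ (mem_Ico.2 ⟨by omega, by omega⟩) hlh
    have key := PLDCert.sum_le_of_cert M hPLD 12 hr' _ hadm _ _ hcert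
    rw [← Finset.mul_sum, ← Finset.mul_sum] at key
    exact Nat.le_of_mul_le_mul_left key hDpos
  rcases Nat.lt_or_ge δ 13 with hδ12 | hδ12
  · obtain ⟨hDpos, hadm, hcert⟩ := col_uniform_3_5_table_12_part12 _ rfl lo (mem_range.2 (by omega)) hi (mem_range.2 (by omega))
      δ (mem_Ico.2 ⟨by omega, by omega⟩) hlh
    have key := PLDCert.sum_le_of_cert M hPLD 12 hr' _ hadm _ _ hcert
    rw [← Finset.mul_sum, ← Finset.mul_sum] at key
    exact Nat.le_of_mul_le_mul_left key hDpos
  rcases Nat.lt_or_ge δ 14 with hδ13 | hδ13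
  · obtain ⟨hDpos, hadm, hcert⟩ := col_uniform_3_5_table_12_part13 _ rfl lo (mem_range.2 (by omega)) hi (mem_range.2 (by omega))
      δ (mem_Ico.2 ⟨by omega, by omega⟩) hlh
    have key := PLDCert.sum_le_of_cert M hPLD 12 hr' _ hadm _ _ hcert
    rw [← Finset.mul_sum, ← Finset.mul_sum] at key
    exact Nat.le_of_mul_le_mul_left key hDpos
  rcases Nat.lt_or_ge δ 15 with hδ14 | hδ14
  · obtain ⟨hDpos, hadm, hcert⟩ := col_uniform_3_5_table_12_part14 _ rfl lo (mem_range.2 (by omega)) hi (mem_range.2 (by omega))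
      δ (mem_Ico.2 ⟨by omega, by omega⟩) hlh
    have key := PLDCert.sum_le_of_cert M hPLD 12 hr' _ hadm _ _ hcert
    rw [← Finset.mul_sum, ← Finset.mul_sum] at key
    exact Nat.le_of_mul_le_mul_left key hDpos
  rcases Nat.lt_or_ge δ 16 with hδ15 | hδ15
  · obtain ⟨hDpos, hadm, hcert⟩ := col_uniform_3_5_table_12_part15 _ rfl lo (mem_range.2 (by omega)) hi (mem_range.2 (by omega))
      δ (mem_Ico.2 ⟨by omega, by omega⟩) hlh
    have key := PLDCert.sum_le_of_cert M hPLD 12 hr' _ hadm _ _ hcert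
    rw [← Finset.mul_sum, ← Finset.mul_sum] at key
    exact Nat.le_of_mul_le_mul_left key hDpos
  obtain ⟨hDpos, hadm, hcert⟩ := col_uniform_3_5_table_12_part16 _ rfl lo (mem_range.2 (by omega)) hi (mem_range.2 (by omega))
    δ (mem_Ico.2 ⟨by omega, by omega⟩) hlh
  have key := PLDCert.sum_le_of_cert M hPLD 12 hr' _ hadm _ _ hcert
  rw [← Finset.mul_sum, ← Finset.mul_sum] at key
  exact Nat.le_of_mul_le_mul_left key hDpos

end PLDColoop

end PercRepro
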